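import Literature.Barriers.CriticalPhenomena.HaraGaussianLemmaConvolution
import HarnessLib

/-!
# Hara's Lemma B.1 (ii): the convolution of `A⟦x⟧^{-(d-2)} + O(⟦x⟧^{-(d-2+s)})` with an even
# `O(⟦x⟧^{-(d+s)})`

Support file for the decomposition of the named fact `Hara2008_gaussianConvolution`
(`LaceExpansionXSpaceAsymptotics.lean`; Hara 2008, Cor. 1.4: "follows immediately from Theorem 1.3
and a basic property of convolutions, Lemma B.1 … This is because `H(x) = (C*g)(x)`"). This file
PROVES Hara 2008, Lemma B.1 (ii) = Hara–van der Hofstad–Slade 2003, Prop. 1.7 (ii) (case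
`s < 2`):

* `exists_convolution_asymptotics` — for `d ≥ 3`, `0 < s < 2` there is `C = C(d,s)` with
  `|(f*g)(x) - A Σ_y g(y) ⟦x⟧^{-(d-2)}| ≤ C K (A+B) ⟦x⟧^{-(d-2+s)}` whenever
  `|f(x) - A⟦x⟧^{-(d-2)}| ≤ B⟦x⟧^{-(d-2+s)}`, `|g(x)| ≤ K⟦x⟧^{-(d+s)}` and `g` is even
  (the sources assume `ℤ^d`-symmetry of `f` and `g`; evenness of `g` is what the proof uses).

The proof follows Hara–van der Hofstad–Slade 2003, §5: the error term of `f` is convolved by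
Lemma B.1 (i) (`HaraGaussianLemmaConvolution.lean`); in the main term
`X = Σ_y g(y)[⟦x-y⟧^{-(d-2)} - ⟦x⟧^{-(d-2)}]` the region `|y| > |x|/2` is an error term by the
tail of `g` (`exists_convolution_ii_outer`, splitting once more at `|x-y| = |x|/4` — the printed
appeal to part (i) with both exponents `d-2` needs `d > 4`), and on `|y| ≤ |x|/2` "because of the
`ℤ^d`-symmetry of `g(y)`, odd powers of `y` in the expansion give no contribution": pairing `y`
with `-y` reduces to the symmetric second difference
`| |x-y|^{2-d} + |x+y|^{2-d} - 2|x|^{2-d} | ≤ c|y|²|x|^{-d}` (`exists_convolution_ii_inner`).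

## References

* T. Hara, Ann. Probab. 36 (2008) 530–593, Appendix B, Lemma B.1 (ii); Cor. 1.4 and the
  sentence after it.
* T. Hara, R. van der Hofstad, G. Slade, Ann. Probab. 31 (2003) 349–408, Prop. 1.7 (ii) and its
  proof (§5: the terms `X₁`, `X₂`, "Let `h(t) = [|x|(1+t)+1]^{2-d}` …").
-/

noncomputable section

namespace Literature.Barriers.CriticalPhenomena

open MeasureTheory Finset Literature.Probability.LatticeModels

variable {d : ℕ}

/-! ### Hara's Lemma B.1 (ii): the main term -/

/-- `Σ_x |g(x)| < ∞` when `|g(x)| ≤ K ⟦x⟧^{-t}`, `t > d`. [folklore] -/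
theorem summable_abs_of_decay_mul {g : Site d → ℝ} {K t : ℝ} (hg : ∀ y, |g y| ≤ K * jnorm y ^ (-t))
    (ht : (d : ℝ) < t) : Summable fun y => |g y| :=
  Summable.of_nonneg_of_le (fun _ => abs_nonneg _) hg ((summable_jnorm_rpow_neg ht).mul_left K)

/-- The tail of a decaying function: `Σ_{|y| > |x|/2} |g(y)| ≤ 2^s C_t K ⟦x⟧^{-s}` when
`|g(y)| ≤ K⟦y⟧^{-(d+s)}`, `C_t` the constant of the Euclidean tail sum. [folklore] -/
theorem tsum_indicator_compl_abs_le {s : ℝ} (hs0 : 0 < s) {Ct : ℝ}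
    (htail : ∀ R : ℝ, ∑' y, {y : Site d | euclidNorm y ≤ R}ᶜ.indicator (fun y => jnorm y ^ (-((d : ℝ) + s))) y ≤
      Ct * (max R 1) ^ ((d : ℝ) - ((d : ℝ) + s)))
    {g : Site d → ℝ} {K : ℝ} (hg : ∀ y, |g y| ≤ K * jnorm y ^ (-((d : ℝ) + s))) (x : Site d) :
    ∑' y, {y : Site d | euclidNorm y ≤ euclidNorm x / 2}ᶜ.indicator (fun y => |g y|) y ≤
      2 ^ s * Ct * K * jnorm x ^ (-s) := by
  set S : Set (Site d) := {y : Site d | euclidNorm y ≤ euclidNorm x / 2} with hS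
  have hK : 0 ≤ K := nonneg_of_decay hg
  have hCt : 0 ≤ Ct := by
    have h := (tsum_nonneg fun y => Set.indicator_nonneg (fun _ _ => Real.rpow_nonneg (jnorm_pos _).le _) y).trans
      (htail 1)
    simpa using h
  have hsum : Summable fun y => jnorm y ^ (-((d : ℝ) + s)) := summable_jnorm_rpow_neg (by linarith)
  have hgs : Summable fun y => |g y| := summable_abs_of_decay_mul hg (by linarith)
  calc ∑' y, Sᶜ.indicator (fun y => |g y|) y ≤ ∑' y, Sᶜ.indicator (fun y => K * jnorm y ^ (-((d : ℝ) + s))) y := by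
        refine Summable.tsum_le_tsum (fun y => ?_) (hgs.indicator _) ((hsum.mul_left K).indicator _)
        by_cases hy : y ∈ Sᶜ
        · rw [Set.indicator_of_mem hy, Set.indicator_of_mem hy]; exact hg y
        · rw [Set.indicator_of_notMem hy, Set.indicator_of_notMem hy]
    _ = K * ∑' y, Sᶜ.indicator (fun y => jnorm y ^ (-((d : ℝ) + s))) y := by
        rw [← tsum_mul_left]
        exact tsum_congr fun y => Set.indicator_mul_right Sᶜ (fun _ => K) _
    _ ≤ K * (Ct * (max (euclidNorm x / 2) 1) ^ ((d : ℝ) - ((d : ℝ) + s))) := mul_le_mul_of_nonneg_left (htail _) hK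
    _ = K * Ct * (max (euclidNorm x / 2) 1) ^ (-s) := by ring_nf
    _ ≤ K * Ct * (2 ^ s * jnorm x ^ (-s)) :=
        mul_le_mul_of_nonneg_left (max_div_one_rpow_neg_le x (by norm_num) hs0.le) (mul_nonneg hK hCt)
    _ = 2 ^ s * Ct * K * jnorm x ^ (-s) := by ring

/-- The outer region `|y| > |x|/2` of the main term of Lemma B.1 (ii):
`|Σ_{|y|>|x|/2} g(y) (⟦x-y⟧^{-(d-2)} - ⟦x⟧^{-(d-2)})| ≤ C K ⟦x⟧^{-(d-2+s)}` when
`|g(y)| ≤ K ⟦y⟧^{-(d+s)}` (split further at `|x - y| = |x|/4`).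
[cite: HaraHofstadSlade2003, proof of Prop. 1.7 (ii), the term X₁ (§5)] -/
theorem exists_convolution_ii_outer (hd : 3 ≤ d) {s : ℝ} (hs0 : 0 < s) :
    ∃ C : ℝ, 0 ≤ C ∧ ∀ (g : Site d → ℝ) (K : ℝ), (∀ y, |g y| ≤ K * jnorm y ^ (-((d : ℝ) + s))) → ∀ x,
      |∑' y, {y : Site d | euclidNorm y ≤ euclidNorm x / 2}ᶜ.indicator
          (fun y => g y * (jnorm (x - y) ^ (-((d : ℝ) - 2)) - jnorm x ^ (-((d : ℝ) - 2)))) y| ≤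
        C * K * jnorm x ^ (-((d : ℝ) - 2 + s)) := by
  have hd1 : 1 ≤ d := by omega
  have hdR : (3 : ℝ) ≤ d := by exact_mod_cast hd
  obtain ⟨Ct, hCt, htail⟩ := exists_tsum_tail_jnorm_rpow_neg_le hd1 (s := (d : ℝ) + s) (by linarith)
  obtain ⟨Cb, hCb, hball⟩ := exists_tsum_ball_jnorm_rpow_neg_le hd1 (a := (d : ℝ) - 2) (by linarith) (by linarith)
  refine ⟨(4 / 3 : ℝ) ^ ((d : ℝ) + s) * Cb + 4 ^ ((d : ℝ) - 2) * (2 ^ s * Ct) + 2 ^ s * Ct, by positivity,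
    fun g K hg x => ?_⟩
  set m : ℝ := (d : ℝ) - 2 with hm
  have hm0 : 0 ≤ m := by rw [hm]; linarith
  have hK : 0 ≤ K := nonneg_of_decay hg
  have hx := jnorm_pos x
  have hgs : Summable fun y => |g y| := summable_abs_of_decay_mul hg (by linarith)
  set S : Set (Site d) := {y : Site d | euclidNorm y ≤ euclidNorm x / 2} with hS
  set G : Site d → ℝ := fun y => g y * (jnorm (x - y) ^ (-m) - jnorm x ^ (-m)) with hG
  have hle1 : ∀ z : Site d, jnorm z ^ (-m) ≤ 1 := fun z =>
    Real.rpow_le_one_of_one_le_of_nonpos (one_le_jnorm z) (by linarith)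
  have hGs : Summable G := by
    refine Summable.of_norm_bounded (hgs.mul_left 2) fun y => ?_
    rw [Real.norm_eq_abs, hG, abs_mul, mul_comm]
    refine mul_le_mul_of_nonneg_right ?_ (abs_nonneg _)
    have h1 := hle1 (x - y); have h2 := hle1 x
    have h3 := Real.rpow_nonneg (jnorm_pos (x - y)).le (-m); have h4 := Real.rpow_nonneg hx.le (-m)
    rw [abs_le]; constructor <;> linarith
  -- the tail of `g`
  have htg : ∑' y, Sᶜ.indicator (fun y => |g y|) y ≤ 2 ^ s * Ct * K * jnorm x ^ (-s) :=
    tsum_indicator_compl_abs_le hs0 htail hg x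
  -- termwise bound on the outer region
  set Φ₁ : Site d → ℝ := fun y => |g y| * jnorm (x - y) ^ (-m) with hΦ₁
  have hΦ₁s : Summable Φ₁ := by
    refine Summable.of_norm_bounded hgs fun y => ?_
    rw [Real.norm_eq_abs, hΦ₁, abs_mul, abs_abs, abs_of_nonneg (Real.rpow_nonneg (jnorm_pos _).le _)]
    exact mul_le_of_le_one_right (abs_nonneg _) (hle1 _)
  have hbound : |∑' y, Sᶜ.indicator G y| ≤ ∑' y, Sᶜ.indicator Φ₁ y + jnorm x ^ (-m) * ∑' y, Sᶜ.indicator (fun y => |g y|) y := by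
    have hsum : Summable (Sᶜ.indicator fun y => Φ₁ y + jnorm x ^ (-m) * |g y|) :=
      (hΦ₁s.add (hgs.mul_left _)).indicator _
    refine (abs_tsum_indicator_le hGs hsum fun y _ => ?_).trans (le_of_eq ?_)
    · rw [hG, hΦ₁, abs_mul]
      simp only
      have h3 := Real.rpow_nonneg (jnorm_pos (x - y)).le (-m); have h4 := Real.rpow_nonneg hx.le (-m)
      calc |g y| * |jnorm (x - y) ^ (-m) - jnorm x ^ (-m)| ≤ |g y| * (jnorm (x - y) ^ (-m) + jnorm x ^ (-m)) := by
            refine mul_le_mul_of_nonneg_left ?_ (abs_nonneg _)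
            rw [abs_le]; constructor <;> linarith
        _ = |g y| * jnorm (x - y) ^ (-m) + jnorm x ^ (-m) * |g y| := by ring
    · rw [← tsum_mul_left, ← Summable.tsum_add (hΦ₁s.indicator _) ((hgs.indicator _).mul_left _)]
      refine tsum_congr fun y => ?_
      by_cases hy : y ∈ Sᶜ
      · simp only [Set.indicator_of_mem hy]
      · simp only [Set.indicator_of_notMem hy, mul_zero, add_zero]
  -- the sum of `Φ₁` over the outer region, split at `|x - y| = |x|/4`
  set R : Set (Site d) := {y : Site d | euclidNorm (x - y) ≤ euclidNorm x / 4} with hR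
  have hΦ₁split : ∑' y, Sᶜ.indicator Φ₁ y = ∑' y, R.indicator (Sᶜ.indicator Φ₁) y + ∑' y, Rᶜ.indicator (Sᶜ.indicator Φ₁) y :=
    tsum_eq_tsum_indicator_add_compl (hΦ₁s.indicator _) R
  -- near `x`: `|y| ≥ 3|x|/4`, so `|g(y)| ≤ K (4/3)^{d+s} ⟦x⟧^{-(d+s)}`
  have hnear : ∑' y, R.indicator (Sᶜ.indicator Φ₁) y ≤ (4 / 3 : ℝ) ^ ((d : ℝ) + s) * Cb * K * jnorm x ^ (-(m + s)) := by
    set c₀ : ℝ := K * (4 / 3 : ℝ) ^ ((d : ℝ) + s) * jnorm x ^ (-((d : ℝ) + s)) with hc₀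
    have hc₀0 : 0 ≤ c₀ := mul_nonneg (by positivity) (Real.rpow_nonneg hx.le _)
    have hRs : Summable (R.indicator fun y => c₀ * jnorm (x - y) ^ (-m)) := by
      have h := summable_indicator_ball (euclidNorm x / 4) (fun z : Site d => c₀ * jnorm z ^ (-m))
      have h' := (Equiv.subLeft x).summable_iff.2 h
      refine h'.congr fun y => ?_
      simp only [Function.comp_apply, Equiv.subLeft_apply, Set.indicator_apply, Set.mem_setOf_eq, hR]
    calc ∑' y, R.indicator (Sᶜ.indicator Φ₁) y ≤ ∑' y, R.indicator (fun y => c₀ * jnorm (x - y) ^ (-m)) y := by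
          refine Summable.tsum_le_tsum (fun y => ?_) ((hΦ₁s.indicator _).indicator _) hRs
          by_cases hyR : y ∈ R
          · rw [Set.indicator_of_mem hyR, Set.indicator_of_mem hyR]
            refine (Set.indicator_le_self' (fun _ _ => mul_nonneg (abs_nonneg _) (Real.rpow_nonneg (jnorm_pos _).le _)) y).trans ?_
            refine mul_le_mul_of_nonneg_right ?_ (Real.rpow_nonneg (jnorm_pos _).le _)
            have hyR' : euclidNorm (x - y) ≤ euclidNorm x / 4 := hyR
            have hxy : jnorm x ≤ (4 / 3 : ℝ) * jnorm y :=
              jnorm_le_mul_jnorm (by norm_num) (by linarith [euclidNorm_le_sub_add x y])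
            have h1 := jnorm_rpow_neg_le_of_jnorm_le (by norm_num) (by linarith : (0 : ℝ) ≤ (d : ℝ) + s) hxy
            calc |g y| ≤ K * jnorm y ^ (-((d : ℝ) + s)) := hg y
              _ ≤ K * ((4 / 3 : ℝ) ^ ((d : ℝ) + s) * jnorm x ^ (-((d : ℝ) + s))) := mul_le_mul_of_nonneg_left h1 hK
              _ = c₀ := by rw [hc₀]; ring
          · rw [Set.indicator_of_notMem hyR, Set.indicator_of_notMem hyR]
      _ = c₀ * ∑' y, R.indicator (fun y => jnorm (x - y) ^ (-m)) y := by
          rw [← tsum_mul_left]; exact tsum_congr fun y => Set.indicator_mul_right R (fun _ => c₀) _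
      _ = c₀ * ∑' z, {z : Site d | euclidNorm z ≤ euclidNorm x / 4}.indicator (fun z => jnorm z ^ (-m)) z := by
          congr 1
          rw [← tsum_comp_sub_left ({z : Site d | euclidNorm z ≤ euclidNorm x / 4}.indicator fun z => jnorm z ^ (-m)) x]
          refine tsum_congr fun y => ?_
          simp only [Set.indicator_apply, Set.mem_setOf_eq, hR]
      _ ≤ c₀ * (Cb * (max (euclidNorm x / 4) 1) ^ ((d : ℝ) - m)) := mul_le_mul_of_nonneg_left (hball _) hc₀0
      _ ≤ c₀ * (Cb * jnorm x ^ ((d : ℝ) - m)) :=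
          mul_le_mul_of_nonneg_left (mul_le_mul_of_nonneg_left (max_div_one_rpow_le x (by norm_num) (by linarith)) hCb) hc₀0
      _ = (4 / 3 : ℝ) ^ ((d : ℝ) + s) * Cb * K * (jnorm x ^ (-((d : ℝ) + s)) * jnorm x ^ ((d : ℝ) - m)) := by
          rw [hc₀]; ring
      _ = (4 / 3 : ℝ) ^ ((d : ℝ) + s) * Cb * K * jnorm x ^ (-(m + s)) := by
          rw [jnorm_rpow_mul_rpow, hm]; ring_nf
  -- far from `x`: `⟦x - y⟧^{-m} ≤ 4^m ⟦x⟧^{-m}` and the tail of `g`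
  have hfar : ∑' y, Rᶜ.indicator (Sᶜ.indicator Φ₁) y ≤ 4 ^ m * (2 ^ s * Ct) * K * jnorm x ^ (-(m + s)) := by
    have hsum2 : Summable fun y => 4 ^ m * jnorm x ^ (-m) * Sᶜ.indicator (fun y => |g y|) y :=
      ((hgs.indicator _).mul_left _)
    calc ∑' y, Rᶜ.indicator (Sᶜ.indicator Φ₁) y ≤ ∑' y, 4 ^ m * jnorm x ^ (-m) * Sᶜ.indicator (fun y => |g y|) y := by
          refine Summable.tsum_le_tsum (fun y => ?_) ((hΦ₁s.indicator _).indicator _) hsum2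
          have hnn : 0 ≤ 4 ^ m * jnorm x ^ (-m) * Sᶜ.indicator (fun y => |g y|) y :=
            mul_nonneg (mul_nonneg (by positivity) (Real.rpow_nonneg hx.le _)) (Set.indicator_nonneg (fun _ _ => abs_nonneg _) y)
          by_cases hyR : y ∈ Rᶜ
          · rw [Set.indicator_of_mem hyR]
            by_cases hyS : y ∈ Sᶜ
            · rw [Set.indicator_of_mem hyS, Set.indicator_of_mem hyS, hΦ₁]
              have hyR' : euclidNorm x / 4 < euclidNorm (x - y) := not_le.1 hyR
              have hxy : jnorm x ≤ 4 * jnorm (x - y) := jnorm_le_mul_jnorm (by norm_num) (by linarith)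
              have h1 := jnorm_rpow_neg_le_of_jnorm_le (by norm_num) hm0 hxy
              calc |g y| * jnorm (x - y) ^ (-m) ≤ |g y| * (4 ^ m * jnorm x ^ (-m)) :=
                    mul_le_mul_of_nonneg_left h1 (abs_nonneg _)
                _ = 4 ^ m * jnorm x ^ (-m) * |g y| := by ring
            · rw [Set.indicator_of_notMem hyS, Set.indicator_of_notMem hyS, mul_zero]
          · rw [Set.indicator_of_notMem hyR]; exact hnn
      _ = 4 ^ m * jnorm x ^ (-m) * ∑' y, Sᶜ.indicator (fun y => |g y|) y := tsum_mul_left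
      _ ≤ 4 ^ m * jnorm x ^ (-m) * (2 ^ s * Ct * K * jnorm x ^ (-s)) :=
          mul_le_mul_of_nonneg_left htg (mul_nonneg (by positivity) (Real.rpow_nonneg hx.le _))
      _ = 4 ^ m * (2 ^ s * Ct) * K * (jnorm x ^ (-m) * jnorm x ^ (-s)) := by ring
      _ = 4 ^ m * (2 ^ s * Ct) * K * jnorm x ^ (-(m + s)) := by rw [jnorm_rpow_mul_rpow]; ring_nf
  -- the `⟦x⟧^{-m}`-term
  have hconst : jnorm x ^ (-m) * ∑' y, Sᶜ.indicator (fun y => |g y|) y ≤ 2 ^ s * Ct * K * jnorm x ^ (-(m + s)) := by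
    calc jnorm x ^ (-m) * ∑' y, Sᶜ.indicator (fun y => |g y|) y ≤ jnorm x ^ (-m) * (2 ^ s * Ct * K * jnorm x ^ (-s)) :=
          mul_le_mul_of_nonneg_left htg (Real.rpow_nonneg hx.le _)
      _ = 2 ^ s * Ct * K * (jnorm x ^ (-m) * jnorm x ^ (-s)) := by ring
      _ = 2 ^ s * Ct * K * jnorm x ^ (-(m + s)) := by rw [jnorm_rpow_mul_rpow]; ring_nf
  calc |∑' y, Sᶜ.indicator G y| ≤ ∑' y, Sᶜ.indicator Φ₁ y + jnorm x ^ (-m) * ∑' y, Sᶜ.indicator (fun y => |g y|) y := hbound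
    _ = ∑' y, R.indicator (Sᶜ.indicator Φ₁) y + ∑' y, Rᶜ.indicator (Sᶜ.indicator Φ₁) y +
          jnorm x ^ (-m) * ∑' y, Sᶜ.indicator (fun y => |g y|) y := by rw [hΦ₁split]
    _ ≤ (4 / 3 : ℝ) ^ ((d : ℝ) + s) * Cb * K * jnorm x ^ (-(m + s)) + 4 ^ m * (2 ^ s * Ct) * K * jnorm x ^ (-(m + s)) +
          2 ^ s * Ct * K * jnorm x ^ (-(m + s)) := add_le_add (add_le_add hnear hfar) hconst
    _ = _ := by rw [hm]; ring


/-- The inner region `|y| ≤ |x|/2` of the main term of Lemma B.1 (ii):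
`|Σ_{|y|≤|x|/2} g(y) (⟦x-y⟧^{-(d-2)} - ⟦x⟧^{-(d-2)})| ≤ C K ⟦x⟧^{-(d-2+s)}` when `g` is even and
`|g(y)| ≤ K ⟦y⟧^{-(d+s)}`, `0 < s < 2`: pairing `y` with `-y` ("odd powers of `y` give no
contribution") and the second-order bound `| |x-y|^{2-d} + |x+y|^{2-d} - 2|x|^{2-d} | ≤ c|y|²|x|^{-d}`.
[cite: HaraHofstadSlade2003, proof of Prop. 1.7 (ii), the term X₂ (§5)] -/
theorem exists_convolution_ii_inner (hd : 3 ≤ d) {s : ℝ} (hs0 : 0 < s) (hs2 : s < 2) :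
    ∃ C : ℝ, 0 ≤ C ∧ ∀ (g : Site d → ℝ) (K : ℝ), (∀ y, g (-y) = g y) →
      (∀ y, |g y| ≤ K * jnorm y ^ (-((d : ℝ) + s))) → ∀ x,
      |∑' y, {y : Site d | euclidNorm y ≤ euclidNorm x / 2}.indicator
          (fun y => g y * (jnorm (x - y) ^ (-((d : ℝ) - 2)) - jnorm x ^ (-((d : ℝ) - 2)))) y| ≤
        C * K * jnorm x ^ (-((d : ℝ) - 2 + s)) := by
  have hd1 : 1 ≤ d := by omega
  have hdR : (3 : ℝ) ≤ d := by exact_mod_cast hd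
  obtain ⟨n, hn⟩ : ∃ n : ℕ, d = n + 2 := ⟨d - 2, by omega⟩
  have hn1 : 1 ≤ n := by omega
  have hnR : (n : ℝ) = (d : ℝ) - 2 := by rw [hn]; push_cast; ring
  obtain ⟨Cb, hCb, hball⟩ := exists_tsum_ball_jnorm_rpow_neg_le hd1 (a := (d : ℝ) + s - 2) (by linarith) (by linarith)
  have hsumt := summable_jnorm_rpow_neg (d := d) (s := (d : ℝ) + s) (by linarith)
  set Ctot := ∑' z : Site d, jnorm z ^ (-((d : ℝ) + s)) with hCtot
  have hCtot0 : 0 ≤ Ctot := tsum_nonneg fun z => Real.rpow_nonneg (jnorm_pos z).le _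
  set Csym : ℝ := n * (n + 1) * 4 ^ (n + 1) with hCsym
  have hCsym0 : 0 ≤ Csym := by positivity
  refine ⟨Ctot * 4 ^ ((d : ℝ) - 2 + s) + Csym * Cb, by positivity, fun g K hg_even hg x => ?_⟩
  set m : ℝ := (d : ℝ) - 2 with hm
  have hm0 : 0 ≤ m := by rw [hm]; linarith
  have hK : 0 ≤ K := nonneg_of_decay hg
  have hx := jnorm_pos x
  have hgs : Summable fun y => |g y| := summable_abs_of_decay_mul hg (by linarith)
  set S : Set (Site d) := {y : Site d | euclidNorm y ≤ euclidNorm x / 2} with hS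
  set G : Site d → ℝ := fun y => g y * (jnorm (x - y) ^ (-m) - jnorm x ^ (-m)) with hG
  set G' : Site d → ℝ := fun y => g y * (jnorm (x + y) ^ (-m) - jnorm x ^ (-m)) with hG'
  have hle1 : ∀ z : Site d, jnorm z ^ (-m) ≤ 1 := fun z =>
    Real.rpow_le_one_of_one_le_of_nonpos (one_le_jnorm z) (by linarith)
  have hdiff : ∀ z : Site d, |jnorm z ^ (-m) - jnorm x ^ (-m)| ≤ 1 := fun z => by
    have h1 := hle1 z; have h2 := hle1 x
    have h3 := Real.rpow_nonneg (jnorm_pos z).le (-m); have h4 := Real.rpow_nonneg hx.le (-m)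
    rw [abs_le]; constructor <;> linarith
  have hGb : ∀ y, |G y| ≤ |g y| := fun y => by
    rw [hG, abs_mul]; exact mul_le_of_le_one_right (abs_nonneg _) (hdiff _)
  have hG'b : ∀ y, |G' y| ≤ |g y| := fun y => by
    rw [hG', abs_mul]; exact mul_le_of_le_one_right (abs_nonneg _) (hdiff _)
  have hGs : Summable G := Summable.of_norm_bounded hgs fun y => (Real.norm_eq_abs _).le.trans (hGb y)
  have hG's : Summable G' := Summable.of_norm_bounded hgs fun y => (Real.norm_eq_abs _).le.trans (hG'b y)
  have htarget : 0 ≤ jnorm x ^ (-(m + s)) := Real.rpow_nonneg hx.le _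
  rcases lt_or_ge (euclidNorm x) 4 with hx4 | hx4
  · -- small `x`: the sum is at most `Σ|g| ≤ K Ctot`, and `⟦x⟧ < 4`
    have h1 : |∑' y, S.indicator G y| ≤ K * Ctot := by
      calc |∑' y, S.indicator G y| ≤ ∑' y, S.indicator (fun y => |g y|) y :=
            abs_tsum_indicator_le hGs (hgs.indicator _) fun y _ => hGb y
        _ ≤ ∑' y, |g y| := Summable.tsum_le_tsum (fun y => Set.indicator_le_self' (fun _ _ => abs_nonneg _) y)
            (hgs.indicator _) hgs
        _ ≤ ∑' y, K * jnorm y ^ (-((d : ℝ) + s)) := Summable.tsum_le_tsum hg hgs (hsumt.mul_left K)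
        _ = K * Ctot := tsum_mul_left
    have h2 : (1 : ℝ) ≤ 4 ^ (m + s) * jnorm x ^ (-(m + s)) := by
      have hj4 : jnorm x ≤ 4 := max_le hx4.le (by norm_num)
      have h3 : (4 : ℝ) ^ (-(m + s)) ≤ jnorm x ^ (-(m + s)) := Real.rpow_le_rpow_of_nonpos hx hj4 (by linarith)
      calc (1 : ℝ) = 4 ^ (m + s) * 4 ^ (-(m + s)) := by
            rw [← Real.rpow_add (by norm_num)]; simp
        _ ≤ 4 ^ (m + s) * jnorm x ^ (-(m + s)) := mul_le_mul_of_nonneg_left h3 (by positivity)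
    calc |∑' y, S.indicator G y| ≤ K * Ctot * 1 := by rw [mul_one]; exact h1
      _ ≤ K * Ctot * (4 ^ (m + s) * jnorm x ^ (-(m + s))) := mul_le_mul_of_nonneg_left h2 (mul_nonneg hK hCtot0)
      _ = Ctot * 4 ^ (m + s) * K * jnorm x ^ (-(m + s)) := by ring
      _ ≤ (Ctot * 4 ^ (m + s) + Csym * Cb) * K * jnorm x ^ (-(m + s)) := by
          have : 0 ≤ Csym * Cb * K * jnorm x ^ (-(m + s)) := by positivity
          nlinarith
  · -- large `x`: pair `y` with `-y`
    have hxpos : 0 < euclidNorm x := by linarith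
    have hjx : jnorm x = euclidNorm x := jnorm_eq_euclidNorm (by linarith)
    have hsymm : ∑' y, S.indicator G y = ∑' y, S.indicator G' y := by
      rw [← (Equiv.neg (Site d)).tsum_eq (S.indicator G)]
      refine tsum_congr fun y => ?_
      rw [Equiv.neg_apply]
      have hmem : (-y ∈ S) ↔ (y ∈ S) := by simp [hS, euclidNorm_neg]
      by_cases hy : y ∈ S
      · rw [Set.indicator_of_mem (hmem.2 hy), Set.indicator_of_mem hy, hG, hG']
        simp only [hg_even y, sub_neg_eq_add]
      · rw [Set.indicator_of_notMem (fun h => hy (hmem.1 h)), Set.indicator_of_notMem hy]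
    have htwo : 2 * ∑' y, S.indicator G y = ∑' y, S.indicator (fun y => G y + G' y) y := by
      rw [two_mul]
      nth_rewrite 2 [hsymm]
      rw [← Summable.tsum_add (hGs.indicator _) (hG's.indicator _)]
      refine tsum_congr fun y => ?_
      by_cases hy : y ∈ S
      · simp only [Set.indicator_of_mem hy]
      · simp only [Set.indicator_of_notMem hy, add_zero]
    -- termwise second-order bound on `S`
    have hterm : ∀ y ∈ S, |G y + G' y| ≤ K * Csym * jnorm x ^ (-(d : ℝ)) * jnorm y ^ (-((d : ℝ) + s - 2)) := by
      intro y hy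
      have hy' : euclidNorm y ≤ euclidNorm x / 2 := hy
      have hty := euclidNorm_nonneg y
      -- the three norms are ≥ 2, hence equal to their regularisations
      have ha1 : euclidNorm x / 2 ≤ euclidNorm (x - y) := by linarith [euclidNorm_le_sub_add x y]
      have hb1 : euclidNorm x / 2 ≤ euclidNorm (x + y) := by
        have := euclidNorm_le_add_add x y; linarith
      have hja : jnorm (x - y) = euclidNorm (x - y) := jnorm_eq_euclidNorm (by linarith)
      have hjb : jnorm (x + y) = euclidNorm (x + y) := jnorm_eq_euclidNorm (by linarith)
      have hapos : 0 < euclidNorm (x - y) := by linarith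
      have hbpos : 0 < euclidNorm (x + y) := by linarith
      have hssd := abs_symm_second_diff_inv_pow_le n hxpos hty hy' (abs_euclidNorm_sub_sub_le x y)
        (abs_euclidNorm_add_sub_le x y) (two_mul_euclidNorm_le x y) (euclidNorm_sub_sq_add_euclidNorm_add_sq x y).le
      have hconv : ∀ z : Site d, jnorm z ^ (-m) = (jnorm z ^ n)⁻¹ := fun z => by
        rw [← hnR, jnorm_rpow_neg_natCast]
      have hsum_eq : G y + G' y = g y * ((jnorm (x - y) ^ n)⁻¹ + (jnorm (x + y) ^ n)⁻¹ - 2 * (jnorm x ^ n)⁻¹) := by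
        simp only [hG, hG', hconv]; ring
      rw [← hjx] at hssd
      rw [hsum_eq, abs_mul, hja, hjb]
      have hxd : jnorm x ^ (n + 2) = jnorm x ^ (d : ℝ) := by
        have hcast : ((n + 2 : ℕ) : ℝ) = (d : ℝ) := by rw [hn]
        rw [← hcast, Real.rpow_natCast]
      calc |g y| * |(euclidNorm (x - y) ^ n)⁻¹ + (euclidNorm (x + y) ^ n)⁻¹ - 2 * (jnorm x ^ n)⁻¹|
          ≤ (K * jnorm y ^ (-((d : ℝ) + s))) * (n * (n + 1) * 4 ^ (n + 1) * euclidNorm y ^ 2 / jnorm x ^ (n + 2)) :=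
            mul_le_mul (hg y) hssd (abs_nonneg _) (mul_nonneg hK (Real.rpow_nonneg (jnorm_pos y).le _))
        _ = K * Csym * (jnorm x ^ (n + 2))⁻¹ * (euclidNorm y ^ 2 * jnorm y ^ (-((d : ℝ) + s))) := by
            rw [hCsym]; ring
        _ ≤ K * Csym * (jnorm x ^ (n + 2))⁻¹ * jnorm y ^ (2 - ((d : ℝ) + s)) := by
            refine mul_le_mul_of_nonneg_left (euclidNorm_sq_mul_jnorm_rpow_neg_le y _) ?_
            exact mul_nonneg (mul_nonneg hK hCsym0) (inv_nonneg.2 (pow_nonneg hx.le _))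
        _ = K * Csym * jnorm x ^ (-(d : ℝ)) * jnorm y ^ (-((d : ℝ) + s - 2)) := by
            rw [hxd, ← Real.rpow_neg hx.le]; ring_nf
    have hbig : |∑' y, S.indicator (fun y => G y + G' y) y| ≤ Csym * Cb * K * jnorm x ^ (-(m + s)) := by
      have hBs : Summable (S.indicator fun y => K * Csym * jnorm x ^ (-(d : ℝ)) * jnorm y ^ (-((d : ℝ) + s - 2))) :=
        summable_indicator_ball _ _
      refine (abs_tsum_indicator_le (hGs.add hG's) hBs hterm).trans ?_
      have e : (S.indicator fun y => K * Csym * jnorm x ^ (-(d : ℝ)) * jnorm y ^ (-((d : ℝ) + s - 2))) =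
          fun y => K * Csym * jnorm x ^ (-(d : ℝ)) * S.indicator (fun y => jnorm y ^ (-((d : ℝ) + s - 2))) y := by
        funext y; exact Set.indicator_mul_right S (fun _ => K * Csym * jnorm x ^ (-(d : ℝ))) _
      rw [e, tsum_mul_left]
      have h3 : (max (euclidNorm x / 2) 1) ^ ((d : ℝ) - ((d : ℝ) + s - 2)) ≤ jnorm x ^ ((d : ℝ) - ((d : ℝ) + s - 2)) :=
        max_div_one_rpow_le x (by norm_num) (by linarith)
      calc K * Csym * jnorm x ^ (-(d : ℝ)) * ∑' y, S.indicator (fun y => jnorm y ^ (-((d : ℝ) + s - 2))) y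
          ≤ K * Csym * jnorm x ^ (-(d : ℝ)) * (Cb * jnorm x ^ ((d : ℝ) - ((d : ℝ) + s - 2))) :=
            mul_le_mul_of_nonneg_left ((hball _).trans (mul_le_mul_of_nonneg_left h3 hCb))
              (mul_nonneg (mul_nonneg hK hCsym0) (Real.rpow_nonneg hx.le _))
        _ = Csym * Cb * K * (jnorm x ^ (-(d : ℝ)) * jnorm x ^ ((d : ℝ) - ((d : ℝ) + s - 2))) := by ring
        _ = Csym * Cb * K * jnorm x ^ (-(m + s)) := by rw [jnorm_rpow_mul_rpow, hm]; ring_nf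
    have hhalf : |∑' y, S.indicator G y| ≤ Csym * Cb * K * jnorm x ^ (-(m + s)) := by
      have h1 : |2 * ∑' y, S.indicator G y| ≤ Csym * Cb * K * jnorm x ^ (-(m + s)) := by rw [htwo]; exact hbig
      rw [abs_mul, abs_two] at h1
      have h2 : 0 ≤ |∑' y, S.indicator G y| := abs_nonneg _
      linarith
    calc |∑' y, S.indicator G y| ≤ Csym * Cb * K * jnorm x ^ (-(m + s)) := hhalf
      _ ≤ (Ctot * 4 ^ (m + s) + Csym * Cb) * K * jnorm x ^ (-(m + s)) := by
          have : 0 ≤ Ctot * 4 ^ (m + s) * K * jnorm x ^ (-(m + s)) := by positivity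
          nlinarith


/-- **Hara 2008, Lemma B.1 (ii)** (= Hara–van der Hofstad–Slade 2003, Prop. 1.7 (ii), case
`s < 2`): let `d > 2` and `0 < s < 2`. There is `C = C(d, s)` such that for every `f` and every
even `g` on `ℤ^d` with `|f(x) - A⟦x⟧^{-(d-2)}| ≤ B⟦x⟧^{-(d-2+s)}` (`A ≥ 0`) and
`|g(x)| ≤ K⟦x⟧^{-(d+s)}`, the convolution satisfies
`|(f*g)(x) - A Σ_y g(y) ⟦x⟧^{-(d-2)}| ≤ C K (A + B) ⟦x⟧^{-(d-2+s)}` for all `x` (printed for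
`ℤ^d`-symmetric `f, g` and positive `A, B, K`; only the evenness of `g` is used).
[cite: Hara2008, Lemma B.1 (ii)] [cite: HaraHofstadSlade2003, Prop. 1.7 (ii) and its proof (§5)] -/
theorem exists_convolution_asymptotics (hd : 3 ≤ d) {s : ℝ} (hs0 : 0 < s) (hs2 : s < 2) :
    ∃ C : ℝ, 0 ≤ C ∧ ∀ (f g : Site d → ℝ) (A B K : ℝ), 0 ≤ A → (∀ y, g (-y) = g y) →
      (∀ x, |f x - A * jnorm x ^ (-((d : ℝ) - 2))| ≤ B * jnorm x ^ (-((d : ℝ) - 2 + s))) →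
      (∀ y, |g y| ≤ K * jnorm y ^ (-((d : ℝ) + s))) → ∀ x,
      |∑' y, f (x - y) * g y - A * (∑' y, g y) * jnorm x ^ (-((d : ℝ) - 2))| ≤
        C * K * (A + B) * jnorm x ^ (-((d : ℝ) - 2 + s)) := by
  have hd1 : 1 ≤ d := by omega
  have hdR : (3 : ℝ) ≤ d := by exact_mod_cast hd
  obtain ⟨Ci, hCi, hconv_i⟩ := exists_convolution_bound_i hd1 (a := (d : ℝ) + s) (b := (d : ℝ) - 2 + s)
    (by linarith) (by linarith) (by linarith)
  obtain ⟨Co, hCo, hout⟩ := exists_convolution_ii_outer hd hs0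
  obtain ⟨Cn, hCn, hinn⟩ := exists_convolution_ii_inner hd hs0 hs2
  refine ⟨Ci + Co + Cn, by positivity, fun f g A B K hA hg_even hf hg x => ?_⟩
  set m : ℝ := (d : ℝ) - 2 with hm
  have hm0 : 0 ≤ m := by rw [hm]; linarith
  have hB : 0 ≤ B := by simpa using (abs_nonneg _).trans (hf 0)
  have hK : 0 ≤ K := nonneg_of_decay hg
  have hx := jnorm_pos x
  have hgs : Summable fun y => |g y| := summable_abs_of_decay_mul hg (by linarith)
  have hgs' : Summable g := summable_abs_iff.1 hgs
  set e : Site d → ℝ := fun z => f z - A * jnorm z ^ (-m) with he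
  have heb : ∀ z, |e z| ≤ B * jnorm z ^ (-(m + s)) := fun z => hf z
  have hle1 : ∀ z : Site d, jnorm z ^ (-m) ≤ 1 := fun z =>
    Real.rpow_le_one_of_one_le_of_nonpos (one_le_jnorm z) (by linarith)
  -- the three pieces are summable
  have hEs : Summable fun y => e (x - y) * g y := by
    refine Summable.of_norm_bounded (hgs.mul_left B) fun y => ?_
    rw [Real.norm_eq_abs, abs_mul]
    refine mul_le_mul_of_nonneg_right ((heb _).trans ?_) (abs_nonneg _)
    exact mul_le_of_le_one_right hB (Real.rpow_le_one_of_one_le_of_nonpos (one_le_jnorm _) (by linarith))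
  have hMs : Summable fun y => A * jnorm (x - y) ^ (-m) * g y := by
    refine Summable.of_norm_bounded (hgs.mul_left A) fun y => ?_
    rw [Real.norm_eq_abs, abs_mul, abs_mul, abs_of_nonneg hA, abs_of_nonneg (Real.rpow_nonneg (jnorm_pos _).le _)]
    exact mul_le_mul_of_nonneg_right (mul_le_of_le_one_right hA (hle1 _)) (abs_nonneg _)
  set G : Site d → ℝ := fun y => g y * (jnorm (x - y) ^ (-m) - jnorm x ^ (-m)) with hG
  have hGs : Summable G := by
    refine Summable.of_norm_bounded (hgs.mul_left 2) fun y => ?_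
    rw [Real.norm_eq_abs, hG, abs_mul, mul_comm]
    refine mul_le_mul_of_nonneg_right ?_ (abs_nonneg _)
    have h1 := hle1 (x - y); have h2 := hle1 x
    have h3 := Real.rpow_nonneg (jnorm_pos (x - y)).le (-m); have h4 := Real.rpow_nonneg hx.le (-m)
    rw [abs_le]; constructor <;> linarith
  -- algebra: convolution = error part + A Σ g ⟦x⟧^{-m} + A X
  have hdecomp : ∑' y, f (x - y) * g y - A * (∑' y, g y) * jnorm x ^ (-m) =
      ∑' y, e (x - y) * g y + A * ∑' y, G y := by
    have h1 : ∑' y, f (x - y) * g y = ∑' y, e (x - y) * g y + ∑' y, A * jnorm (x - y) ^ (-m) * g y := by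
      rw [← Summable.tsum_add hEs hMs]
      exact tsum_congr fun y => by simp only [he]; ring
    have h2 : ∑' y, A * jnorm (x - y) ^ (-m) * g y = A * ∑' y, G y + A * (∑' y, g y) * jnorm x ^ (-m) := by
      have h3 : ∑' y, G y = ∑' y, jnorm (x - y) ^ (-m) * g y - jnorm x ^ (-m) * ∑' y, g y := by
        rw [← tsum_mul_left, ← Summable.tsum_sub]
        · exact tsum_congr fun y => by simp only [hG]; ring
        · refine Summable.of_norm_bounded hgs fun y => ?_
          rw [Real.norm_eq_abs, abs_mul, abs_of_nonneg (Real.rpow_nonneg (jnorm_pos _).le _)]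
          exact mul_le_of_le_one_left (abs_nonneg _) (hle1 _)
        · exact hgs'.mul_left _
      rw [h3, mul_sub, ← tsum_mul_left]
      have : ∑' y, A * jnorm (x - y) ^ (-m) * g y = ∑' y, A * (jnorm (x - y) ^ (-m) * g y) :=
        tsum_congr fun y => by ring
      rw [this]; ring
    rw [h1, h2]; ring
  rw [hdecomp]
  -- the error part, by Lemma B.1 (i)
  have hE : |∑' y, e (x - y) * g y| ≤ Ci * B * K * jnorm x ^ (-(m + s)) := by
    have hswap : ∑' y, e (x - y) * g y = ∑' y, g (x - y) * e y := by
      rw [← tsum_comp_sub_left (fun y => g (x - y) * e y) x]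
      exact tsum_congr fun y => by simp only [sub_sub_cancel]; ring
    rw [hswap]
    calc |∑' y, g (x - y) * e y| ≤ Ci * K * B * jnorm x ^ (-(m + s)) := hconv_i g e K B hg heb x
      _ = Ci * B * K * jnorm x ^ (-(m + s)) := by ring
  -- the main part, inner and outer regions
  set S : Set (Site d) := {y : Site d | euclidNorm y ≤ euclidNorm x / 2} with hS
  have hX : |∑' y, G y| ≤ (Co + Cn) * K * jnorm x ^ (-(m + s)) := by
    rw [tsum_eq_tsum_indicator_add_compl hGs S]
    have h1 := hinn g K hg_even hg x
    have h2 := hout g K hg x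
    calc |∑' y, S.indicator G y + ∑' y, Sᶜ.indicator G y| ≤ |∑' y, S.indicator G y| + |∑' y, Sᶜ.indicator G y| :=
          abs_add_le _ _
      _ ≤ Cn * K * jnorm x ^ (-(m + s)) + Co * K * jnorm x ^ (-(m + s)) := add_le_add h1 h2
      _ = (Co + Cn) * K * jnorm x ^ (-(m + s)) := by ring
  have htarget : 0 ≤ jnorm x ^ (-(m + s)) := Real.rpow_nonneg hx.le _
  calc |∑' y, e (x - y) * g y + A * ∑' y, G y| ≤ |∑' y, e (x - y) * g y| + |A * ∑' y, G y| := abs_add_le _ _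
    _ = |∑' y, e (x - y) * g y| + A * |∑' y, G y| := by rw [abs_mul, abs_of_nonneg hA]
    _ ≤ Ci * B * K * jnorm x ^ (-(m + s)) + A * ((Co + Cn) * K * jnorm x ^ (-(m + s))) :=
        add_le_add hE (mul_le_mul_of_nonneg_left hX hA)
    _ ≤ (Ci + Co + Cn) * K * (A + B) * jnorm x ^ (-(m + s)) := by
        have h1 : 0 ≤ Ci * A * K * jnorm x ^ (-(m + s)) := by positivity
        have h2 : 0 ≤ (Co + Cn) * B * K * jnorm x ^ (-(m + s)) := by positivity
        nlinarith



end Literature.Barriers.CriticalPhenomena
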